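import Literature.MathematicalPhysics.QuantumManyBody.PeriodicFeynmanKacEnergyLower
import Literature.MathematicalPhysics.QuantumManyBody.PeriodicFeynmanKacPerronFrobenius
import HarnessLib

/-!
# Crux `PeriodicIRBound` (stmt-AtomisticToContinuum-3972), line `linear-ph-floor-wagner`, stub S-B
# `stub_fkPositiveOfMinimiser` — part 3: a.s. finiteness of the Feynman–Kac action for an integrable
# interaction, and positivity of the functional at almost every starting point

Helper file of the line lead (seat c2), sequel of `…PFOpNorm.lean` / `…PFJensen.lean`. For an interaction
`V = ∑_{i<j} v^per(xᵢ - xⱼ)` that is merely INTEGRABLE on the cell (hard spikes allowed, no bound), the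
Feynman–Kac action `A_t(X, ω) = ∫₀ᵗ V(B_s) ds` can be infinite — but only on a null set of samples, for almost
every starting point:

* `setLIntegral_cellN_lintegral_periodicPathAction_le` — `∫_cell E_X[A_t] dX ≤ t · ∫_cell V` (Tonelli and the
  shift invariance of cell integrals of periodic functions: the uniform distribution on the torus is stationary);
* `ae_cellN_ae_periodicPathAction_lt_top` — hence `A_t < ∞` `W`-a.s. for a.e. `X ∈ cell`;
* `periodicFKSemigroup_pos_of_ae_action_lt_top`, `pfkReal_pos_of_ae_action_lt_top` — at such `X` the functional
  of a nonnegative observable that is not a.e. zero is STRICTLY POSITIVE (the weight `e^{-A_t}` is a.s. positive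
  and the endpoint `B_t` has a strictly positive Gaussian density, `lintegral_worldLine_pos`): the replacement,
  for unbounded potentials, of the uniform weight floor `e^{-N²Ct}` behind the tree's `pfkReal_pos_of_nonneg`.

References: Reed–Simon IV §XIII.12 (Thm XIII.44: `e^{-tH}` is positivity improving); Chung–Zhao (1995) §3.2.
-/

noncomputable section

open scoped BigOperators ENNReal NNReal InnerProductSpace Topology
open Filter MeasureTheory

namespace Summit.AtomisticToContinuum.BoseEinsteinCondensation.Cruxes.PeriodicIRBound.LinearPhFloorWagner

open Literature.MathematicalPhysics.QuantumManyBody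
open Literature.MathematicalPhysics.QuantumManyBody.BoseGas

variable {N : ℕ}

/-! ## §1 The action is integrable over (cell × paths) -/

/-- **`∫_cell E_X[A_t] dX ≤ t · ∫_cell V`** for the Feynman–Kac action `A_t = ∫₀ᵗ V(B_s)ds` of a measurable
interaction (any real `t`; `ofReal t = 0` for `t ≤ 0`, where the action vanishes; in fact equality): Tonelli (`setLIntegral_cellN_sq_mul_periodicPathAction_eq` with `ψ ≡ 1`)
and the shift invariance `∫_cell V(X + D_s) dX = ∫_cell V` (`lintegral_cellN_comp_add`). [folklore] -/
theorem setLIntegral_cellN_lintegral_periodicPathAction_le {v : ℝ → ℝ≥0∞} (hv : Measurable v) {L : ℝ}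
    (hL : 0 < L) (t : ℝ) :
    ∫⁻ X in cellN N L, ∫⁻ ω, periodicPathAction v L t X ω ∂wienerPaths N ≤
      ENNReal.ofReal t * ∫⁻ X in cellN N L, periodicInteraction v L X := by
  have h := setLIntegral_cellN_sq_mul_periodicPathAction_eq (N := N) hv L (ψ := fun _ => (1 : ℝ))
    measurable_const t
  simp only [one_pow, ENNReal.ofReal_one, one_mul] at h
  rw [h]
  have hper := periodicInteraction_add_single (N := N) v L
  have hinner : ∀ (s : ℝ) (ω : PathSpace N),
      ∫⁻ X in cellN N L, periodicInteraction v L (X + displacement s.toNNReal ω) =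
        ∫⁻ X in cellN N L, periodicInteraction v L X := fun s ω =>
    lintegral_cellN_comp_add hL (G := periodicInteraction v L) hper _
  simp only [hinner, lintegral_const, measure_univ, mul_one]
  rw [Measure.restrict_apply_univ, Real.volume_Ioc, sub_zero, mul_comm]

/-- **The action is a.s. finite for a.e. starting point in the cell** when `∫_cell V < ∞`. [folklore] -/
theorem ae_cellN_ae_periodicPathAction_lt_top {v : ℝ → ℝ≥0∞} (hv : Measurable v) {L : ℝ} (hL : 0 < L)
    (hW : ∫⁻ X in cellN N L, periodicInteraction v L X ≠ ⊤) (t : ℝ) :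
    ∀ᵐ X ∂(volume.restrict (cellN N L)), ∀ᵐ ω ∂wienerPaths N, periodicPathAction v L t X ω < ⊤ := by
  have hmeas : Measurable fun X : Config N => ∫⁻ ω, periodicPathAction v L t X ω ∂wienerPaths N :=
    (measurable_periodicPathAction_uncurry hv L t).lintegral_prod_right'
  have hfin : ∫⁻ X in cellN N L, ∫⁻ ω, periodicPathAction v L t X ω ∂wienerPaths N ≠ ⊤ :=
    ne_top_of_le_ne_top (ENNReal.mul_ne_top ENNReal.ofReal_ne_top hW)
      (setLIntegral_cellN_lintegral_periodicPathAction_le hv hL t)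
  filter_upwards [ae_lt_top hmeas hfin] with X hX
  exact ae_lt_top (measurable_periodicPathAction hv L t X) hX.ne

/-! ## §2 Positivity of the functional at a starting point with a.s. finite action -/

/-- **Positivity of the `[0, ∞]`-valued Feynman–Kac functional** at a starting point `X` whose action is a.s.
finite: for `t > 0` and a measurable `G ≥ 0` that is not a.e. zero, `E_X[e^{-A_t} G(B_t)] > 0` (the weight is
a.s. positive, the endpoint has a strictly positive density). [cite: ReedSimonIV1978, Thm XIII.44] -/
theorem periodicFKSemigroup_pos_of_ae_action_lt_top {v : ℝ → ℝ≥0∞} (hv : Measurable v) {L : ℝ} {t : ℝ}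
    (ht : 0 < t) {X : Config N} (hX : ∀ᵐ ω ∂wienerPaths N, periodicPathAction v L t X ω < ⊤)
    {G : Config N → ℝ≥0∞} (hG : Measurable G) (hne : ¬ G =ᵐ[volume] 0) :
    0 < periodicFKSemigroup v L t G X := by
  have ht' : t.toNNReal ≠ 0 := by simpa using ht
  have hfree : 0 < ∫⁻ ω, G (worldLine X ω t.toNNReal) ∂wienerPaths N := lintegral_worldLine_pos X ht' hG hne
  rw [periodicFKSemigroup]
  refine pos_iff_ne_zero.2 fun h0 => ?_
  have hm : Measurable fun ω => periodicFKWeight v L t X ω * G (worldLine X ω t.toNNReal) :=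
    (measurable_periodicFKWeight hv L t X).mul (hG.comp (measurable_worldLine X _))
  have hae := (lintegral_eq_zero_iff hm).1 h0
  have hG0 : (fun ω => G (worldLine X ω t.toNNReal)) =ᵐ[wienerPaths N] 0 := by
    filter_upwards [hae, hX] with ω hω hωA
    rcases mul_eq_zero.1 hω with hw | hg
    · exact absurd ((periodicFKWeight_eq_zero_iff v L t X ω).1 hw) hωA.ne
    · exact hg
  have h1 : ∫⁻ ω, G (worldLine X ω t.toNNReal) ∂wienerPaths N = 0 := by
    rw [lintegral_congr_ae hG0]
    simp
  rw [h1] at hfree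
  exact lt_irrefl _ hfree

/-- **Positivity of `(e^{-tH} g)(X)` for a real observable `g ≥ 0`** at a starting point with a.s. finite
action (`t, L > 0`; `g` periodic, square-integrable on the cell, not a.e. zero on the cell).
[cite: ReedSimonIV1978, Thm XIII.44] -/
theorem pfkReal_pos_of_ae_action_lt_top {v : ℝ → ℝ≥0∞} (hv : Measurable v) {L : ℝ} (hL : 0 < L) {t : ℝ}
    (ht : 0 < t) {X : Config N} (hX : ∀ᵐ ω ∂wienerPaths N, periodicPathAction v L t X ω < ⊤)
    {g : Config N → ℝ} (hg : Measurable g) (hg0 : ∀ Y, 0 ≤ g Y)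
    (hper : ∀ (Y : Config N) (i : Fin N) (k : Fin 3), g (Y + Pi.single i (EuclideanSpace.single k L)) = g Y)
    (hg2 : ∫⁻ Y in cellN N L, ‖g Y‖ₑ ^ (2 : ℝ) ≠ ⊤) (hne : ¬ g =ᵐ[volume.restrict (cellN N L)] 0) :
    0 < pfkReal v L t g X := by
  set G : Config N → ℝ≥0∞ := fun Y => ENNReal.ofReal (g Y) with hGdef
  have hGm : Measurable G := hg.ennreal_ofReal
  have hGper : ∀ (Y : Config N) (i : Fin N) (k : Fin 3),
      G (Y + Pi.single i (EuclideanSpace.single k L)) = G Y := fun Y i k => by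
    simp only [hGdef, hper]
  have hG2 : ∫⁻ Y in cellN N L, G Y ^ (2 : ℝ) ≠ ⊤ := by
    convert hg2 using 1
    refine lintegral_congr fun Y => ?_
    rw [hGdef, Real.enorm_of_nonneg (hg0 Y)]
  have hGne : ¬ G =ᵐ[volume] 0 := by
    intro h0
    apply hne
    have h1 : G =ᵐ[volume.restrict (cellN N L)] 0 := ae_restrict_of_ae h0
    filter_upwards [h1] with Y hY
    have : ENNReal.ofReal (g Y) = 0 := hY
    exact le_antisymm (ENNReal.ofReal_eq_zero.1 this) (hg0 Y)
  have hpos := periodicFKSemigroup_pos_of_ae_action_lt_top hv ht hX hGm hGne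
  have hfin : periodicFKSemigroup v L t G X < ⊤ := periodicFKSemigroup_lt_top_of_cell v hL ht hGm hGper hG2 X
  rw [pfkReal_eq_toReal_periodicFKSemigroup hv L t hg hg0]
  exact ENNReal.toReal_pos hpos.ne' hfin.ne

/-- **Registered sub-goal `stub_pfPositivity` of the crux item** (S-B part 3, line `linear-ph-floor-wagner`, v11):
positivity of `(e^{-tH} g)(X)` at a starting point with a.s. finite action (`pfkReal_pos_of_ae_action_lt_top`).
[cite: ReedSimonIV1978, Thm XIII.44] -/
theorem stub_pfPositivity :
    ∀ {N : ℕ} {v : ℝ → ℝ≥0∞}, Measurable v → ∀ {L : ℝ}, 0 < L → ∀ {t : ℝ}, 0 < t → ∀ {X : Config N}, (∀ᵐ ω ∂wienerPaths N, periodicPathAction v L t X ω < ⊤) → ∀ {g : Config N → ℝ}, Measurable g → (∀ Y, 0 ≤ g Y) → (∀ (Y : Config N) (i : Fin N) (k : Fin 3), g (Y + Pi.single i (EuclideanSpace.single k L)) = g Y) → (∫⁻ Y in cellN N L, ‖g Y‖ₑ ^ (2 : ℝ)) ≠ ⊤ → (¬ g =ᵐ[volume.restrict (cellN N L)] 0)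 → 0 < pfkReal v L t g X :=
  fun hv _ hL _ ht _ hX _ hg hg0 hper hg2 hne => pfkReal_pos_of_ae_action_lt_top hv hL ht hX hg hg0 hper hg2 hne

end Summit.AtomisticToContinuum.BoseEinsteinCondensation.Cruxes.PeriodicIRBound.LinearPhFloorWagner

end
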